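import Literature.NumberTheory.Automorphic.UnitaryThreeRegularUnipotentCentralizer   -- ★ p849213 REG-CENT (LH5-p02 (g2)): `C_U(u₀) = Z(U)·{u(a,b) : σa = a}`; brings ★ `UnitaryThreeRegularUnipotentClass` (torus∕`N` conjugation formulas) and ★ `UnitaryThreeSingularUnipotentClasses`
import Literature.NumberTheory.Automorphic.IntMatrixLevelConjugation                -- ★ `IsIntMatrix` currency (`UnitaryLatticeTreeDefs`) + `forall_v_conj_sub_one_apply_le_iff`; brings `Valued K ℤᵐ⁰` bookkeeping
import Mathlib.LinearAlgebra.Matrix.ZPow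
import HarnessLib

/-!
# The REGULAR unipotent orbit of the quasi-split `U(3)`: additive coordinates on the centraliser, the one-parameter transversal, torus scaling, and the
# integrality ∕ index bookkeeping for Ranga-Rao convergence ([Rogawski1990] §3.9, §8.1; [Rao1972])

Topic `NumberTheory/Automorphic`; namespace `Literature.NumberTheory.Automorphic.UnitaryGroup`.  THEOREMS ONLY (no definition, no instance, no notation, no named fact, no `sorry`).
Cell `pub/hodgecm-mathlib` (D-0151), crux H413 = `stmt-HodgeConjecture-24833`, line LH4 (Shalika pay-down), organ «RAO-REG-FRAME» (LH4-plan (g2) dealer words #12 (b)): the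
FIELD-LEVEL frame that the REGULAR-class file of RAO-CONV (F0P3a-p09 (g4), `UnipotentOrbitalIntegralConvergenceRegularCM`) imports — over any field `K` with involution `σ`,
for the split form `J₀ = (StdForm.antidiagonal 3).over K`, `U = unitaryGroupOfForm σ J₀`, and REG-CENT's base point `u₀ = !![1, 1, -t₀; 0, 1, -1; 0, 0, 1]`.

THE MATHEMATICS (all checked entrywise).
* §1 `N ∩ U` bookkeeping: products and inverses of upper unitriangular units (`coe_upperTriangularUnipotent_mul`, `…_inv`).
* §2 ADDITIVE COORDINATES on `C_{U∩N}(u₀)` (needs `2 ∈ K^×`): `n(a, s) := !![1, a, s - a^2/2; 0, 1, -a; 0, 0, 1]` with `σa = a`, `σs = -s` is REG-CENT's `u(a, b)`, `b = s − a²∕2`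
  (`b + σb + aσa = 0 ⟺ s + σs = 0`); it lies in `U` and commutes with `u₀` (★ RC2), and **`n(a,s)·n(a′,s′) = n(a + a′, s + s′)`**, `n(a,s)⁻¹ = n(−a, −s)`: the centraliser
  `C_{U∩N}(u₀) ≅ K^σ × K^{σ = −1}` is a PRODUCT OF TWO ADDITIVE LINES — so valuation balls in `(a, s)` give SUBGROUPS `S_j` and `[S_j : S_0]` is a ball index.
* §3 THE TRANSVERSAL: for `ξ ∈ K` with `σξ = −ξ`, `m_κ := !![1, κξ, κ²ξ²/2; 0, 1, κξ; 0, 0, 1]` (`κ ∈ K^σ`) lies in `U ∩ N`, `m_κ m_{κ′} = m_{κ+κ′}` (a ONE-PARAMETER SUBGROUP),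
  `m_κ u₀ m_κ⁻¹ = !![1, 1, -t₀ - 2κξ; 0, 1, -1; 0, 0, 1]` (the commutator coordinate `−2κξ`), `m_κ n(a,s) m_κ⁻¹ = n(a, s − 2κξa)`, and every element of `U ∩ N` is
  `m_κ · n(a, s)` with `κξ = (x − σx)∕2`, `a = (x + σx)∕2` (`x` the `(0,1)` entry): `U ∩ N = M · C_{U∩N}(u₀)`.
* §4 TORUS SCALING: `d(z) = diag(z, 1, (σz)⁻¹)` (★ `exists_units_coe_eq_torusElt`): `d(z)·!![1, x, y; 0, 1, w; 0, 0, 1]·d(z)⁻¹ = !![1, zx, zσz·y; 0, 1, σz·w; 0, 0, 1]` is ★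
  `coe_torusElt_conj_upperTriangularUnipotent`; here the ITERATE `d(z^j)` form used by the unfolding.  NB: `d(z)` normalises `C(u₀)` and `M` only if `σz = z`; at a RAMIFIED
  place no σ-fixed `z` has `v(z) = exp(−1)`, and the road below does NOT need normalisation — only integrality.
* §5 VALUED PART (`[Valued K ℤᵐ⁰]` compatible with `[ValuativeRel K]`, `σ` isometric, `v 2 = 1`): `GL₃(𝒪)`-membership of upper unitriangular units by entries; the
  ABSORPTION `d(z)^j (m_κ n(a,s) m_κ⁻¹) d(z)^{−j} ∈ glInt 3 K` for `j ≥ 0`, `v a ≤ 1`, `v s ≤ (v (zσz))^{−j}`, `v (κξ) ≤ (v (zσz))^{−j}` (⇒ `W_j S_j ⊆ W_j` for `W_j = K d(z)^j M_j`);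
  the COSET CRITERION `d(z)^j m_κ d(z)^{−j} ∈ glInt 3 K ⟺ v (z^j κξ) ≤ 1`; and the SUBGROUP `S_r = {n(a,s) : v a ≤ 1, v s ≤ r}` (existential, no `def`) with its INDEX read on the
  `s`-line.  The numeric values `q^{…}` of the ball indices are ★ `relIndex_leAddSubgroup_exp` (`SubgroupIndexDevissage`) and the index–measure identity is ★
  `measure_subgroup_eq_relIndex_mul_of_isCompact` (`SubgroupRelIndexMeasure`) — cited by the consumer, not restated.
HONEST LABEL: elementary matrix algebra over a field with involution; count-neutral, pays no letter; HC_CM is proved only modulo the 7 printed citations (2 remaining: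
hLiu418 = stmt-HodgeConjecture-24832, h413 = stmt-HodgeConjecture-24833) until rung 0 closes.

## References
* [Rogawski1990] J. D. Rogawski, *Automorphic Representations of Unitary Groups in Three Variables*, Ann. of Math. Stud. 123 (1990): §1.10 p. 9 (`N`, `u(x, z)`), §3.9
  Prop. 3.9.1 p. 32 (the regular class), §4.9 p. 54, §8.1 p. 112.
* [Rao1972] R. Ranga Rao, *Orbital integrals in reductive groups*, Ann. of Math. (2) 96 (1972) 505–510.
-/

set_option autoImplicit false

open Matrix
open scoped Valued WithZero

namespace Literature.NumberTheory.Automorphic.UnitaryGroup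

open Literature.NumberTheory.Automorphic.HermitianLattice

variable {K : Type*} [Field K] (σ : K →+* K)

/-! ## §1 Products and inverses of upper unitriangular units -/

section Unitriangular

/-- **Product of upper unitriangular units**: `!![1,x,y;0,1,w;0,0,1] · !![1,x′,y′;0,1,w′;0,0,1] = !![1, x+x′, y+y′+x·w′; 0, 1, w+w′; 0, 0, 1]`.
[cite: Rogawski1990, §1.10 p. 9] -/
theorem coe_upperTriangularUnipotent_mul {x y w x' y' w' : K} {g g' : GL (Fin 3) K}
    (hg : (g : Matrix (Fin 3) (Fin 3) K) = !![1, x, y; 0, 1, w; 0, 0, 1]) (hg' : (g' : Matrix (Fin 3) (Fin 3) K) = !![1, x', y'; 0, 1, w'; 0, 0, 1]) :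
    ((g * g' : GL (Fin 3) K) : Matrix (Fin 3) (Fin 3) K) = !![1, x + x', y + y' + x * w'; 0, 1, w + w'; 0, 0, 1] := by
  rw [Units.val_mul, hg, hg']
  ext i j
  fin_cases i <;> fin_cases j <;> (simp [Matrix.mul_apply, Fin.sum_univ_three]; try ring)

/-- **Inverse of an upper unitriangular unit**: `!![1,x,y;0,1,w;0,0,1]⁻¹ = !![1, −x, x·w − y; 0, 1, −w; 0, 0, 1]`. [cite: Rogawski1990, §1.10 p. 9] -/
theorem coe_upperTriangularUnipotent_inv {x y w : K} {g : GL (Fin 3) K} (hg : (g : Matrix (Fin 3) (Fin 3) K) = !![1, x, y; 0, 1, w; 0, 0, 1]) :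
    ((g⁻¹ : GL (Fin 3) K) : Matrix (Fin 3) (Fin 3) K) = !![1, -x, x * w - y; 0, 1, -w; 0, 0, 1] := by
  have h1 : (g : Matrix (Fin 3) (Fin 3) K) * !![1, -x, x * w - y; 0, 1, -w; 0, 0, 1] = 1 := by
    rw [hg]
    ext i j; fin_cases i <;> fin_cases j <;> (simp [Matrix.mul_apply, Fin.sum_univ_three]; try ring)
  rw [Matrix.coe_units_inv]
  exact Matrix.inv_eq_right_inv h1

end Unitriangular

/-! ## §2 Additive coordinates on the centraliser `C_{U∩N}(u₀)` -/

section Centraliser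

/-- **`n(a, s) ∈ U` and commutes with `u₀`** (`σa = a`, `σs = −s`, `2 ∈ K^×`): it is REG-CENT's `u(a, b)` with `b = s − a²∕2`, and `b + σb + aσa = 0` because `σs = −s`.
[cite: Rogawski1990, §3.9 p. 32] -/
theorem regCentElt_mem_and_commute (hσ : ∀ z : K, σ (σ z) = z) (h2 : (2 : K) ≠ 0) {t₀ a s : K} (ha : σ a = a) (hs : σ s = -s)
    {u g : GL (Fin 3) K} (hu : (u : Matrix (Fin 3) (Fin 3) K) = !![1, 1, -t₀; 0, 1, -1; 0, 0, 1])
    (hg : (g : Matrix (Fin 3) (Fin 3) K) = !![1, a, s - a ^ 2 / 2; 0, 1, -a; 0, 0, 1]) :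
    g ∈ unitaryGroupOfForm σ ((StdForm.antidiagonal 3).over K) ∧ g * u = u * g := by
  have h22 : (2 : K)⁻¹ * 2 = 1 := inv_mul_cancel₀ h2
  have hb : (s - a ^ 2 / 2) + σ (s - a ^ 2 / 2) + a * σ a = 0 := by
    rw [map_sub, map_div₀, map_pow, map_ofNat, hs, ha]
    linear_combination (-(a ^ 2)) * h22
  refine smul_upperUnipotent_mem_unitaryGroupOfForm_and_commute σ hσ (z := 1) (by rw [map_one, one_mul]) ha hb hu ?_
  rw [one_smul, ha]
  exact hg

/-- **ADDITIVITY: `n(a, s)·n(a′, s′) = n(a + a′, s + s′)`** (`2 ∈ K^×`). [cite: Rogawski1990, §3.9 p. 32] -/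
theorem coe_regCentElt_mul (h2 : (2 : K) ≠ 0) {a s a' s' : K} {g g' : GL (Fin 3) K}
    (hg : (g : Matrix (Fin 3) (Fin 3) K) = !![1, a, s - a ^ 2 / 2; 0, 1, -a; 0, 0, 1])
    (hg' : (g' : Matrix (Fin 3) (Fin 3) K) = !![1, a', s' - a' ^ 2 / 2; 0, 1, -a'; 0, 0, 1]) :
    ((g * g' : GL (Fin 3) K) : Matrix (Fin 3) (Fin 3) K) = !![1, a + a', (s + s') - (a + a') ^ 2 / 2; 0, 1, -(a + a'); 0, 0, 1] := by
  have h22 : (2 : K)⁻¹ * 2 = 1 := inv_mul_cancel₀ h2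
  have e02 : s - a ^ 2 / 2 + (s' - a' ^ 2 / 2) + a * -a' = (s + s') - (a + a') ^ 2 / 2 := by linear_combination (a * a') * h22
  have e12 : -a + -a' = -(a + a') := by ring
  rw [coe_upperTriangularUnipotent_mul hg hg', e02, e12]

/-- **INVERSE: `n(a, s)⁻¹ = n(−a, −s)`** (`2 ∈ K^×`). [cite: Rogawski1990, §3.9 p. 32] -/
theorem coe_regCentElt_inv (h2 : (2 : K) ≠ 0) {a s : K} {g : GL (Fin 3) K}
    (hg : (g : Matrix (Fin 3) (Fin 3) K) = !![1, a, s - a ^ 2 / 2; 0, 1, -a; 0, 0, 1]) :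
    ((g⁻¹ : GL (Fin 3) K) : Matrix (Fin 3) (Fin 3) K) = !![1, -a, -s - (-a) ^ 2 / 2; 0, 1, -(-a); 0, 0, 1] := by
  have h22 : (2 : K)⁻¹ * 2 = 1 := inv_mul_cancel₀ h2
  have e02 : a * -a - (s - a ^ 2 / 2) = -s - (-a) ^ 2 / 2 := by linear_combination (a ^ 2) * h22
  rw [coe_upperTriangularUnipotent_inv hg, e02]

/-- **EVERY element of `C_{U∩N}(u₀)` has coordinates `(a, s)`**: a unitriangular `g ∈ U` commuting with `u₀` is `n(a, s)` with `σa = a`, `σs = −s` (`2 ∈ K^×`; ★ RC1 with the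
scalar `z = 1` read off the `(0,0)` entry). [cite: Rogawski1990, §3.9 p. 32] -/
theorem exists_regCent_coords_of_commute (hσ : ∀ z : K, σ (σ z) = z) (h2 : (2 : K) ≠ 0) {t₀ x y w : K} {u g : GL (Fin 3) K}
    (hu : (u : Matrix (Fin 3) (Fin 3) K) = !![1, 1, -t₀; 0, 1, -1; 0, 0, 1]) (hg : (g : Matrix (Fin 3) (Fin 3) K) = !![1, x, y; 0, 1, w; 0, 0, 1])
    (hU : g ∈ unitaryGroupOfForm σ ((StdForm.antidiagonal 3).over K)) (hcomm : g * u = u * g) :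
    ∃ a s : K, σ a = a ∧ σ s = -s ∧ (g : Matrix (Fin 3) (Fin 3) K) = !![1, a, s - a ^ 2 / 2; 0, 1, -a; 0, 0, 1] := by
  obtain ⟨z, a, b, hz, ha, hb, hgz⟩ := exists_coe_eq_smul_upperUnipotent_of_commute_regularUnipotent σ hσ hu hU hcomm
  -- the scalar is `1`: compare the `(0,0)` entries
  have hz1 : z = 1 := by
    have h00 := congr_fun (congr_fun hgz 0) 0
    rw [hg] at h00
    simpa using h00.symm
  have h22 : (2 : K)⁻¹ * 2 = 1 := inv_mul_cancel₀ h2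
  refine ⟨a, b + a ^ 2 / 2, ha, ?_, ?_⟩
  · rw [map_add, map_div₀, map_pow, map_ofNat, ha]
    rw [ha] at hb
    linear_combination hb + (a ^ 2) * h22
  · have e02 : b = b + a ^ 2 / 2 - a ^ 2 / 2 := by ring
    rw [hgz, hz1, one_smul, ha, ← e02]

end Centraliser

/-! ## §3 The one-parameter transversal `m_κ` and the decomposition `U ∩ N = M · C_{U∩N}(u₀)` -/

section Transversal

/-- **`m_κ ∈ U`** for `σξ = −ξ`, `σκ = κ` (`2 ∈ K^×`): middle entry `κξ = −σ(κξ)`, corner `κ²ξ²∕2` with `κ²ξ²∕2 + σ(κ²ξ²∕2) + κξ·σ(κξ) = 0`.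
[cite: Rogawski1990, §1.10 p. 9] -/
theorem transversal_mem (hσ : ∀ z : K, σ (σ z) = z) (h2 : (2 : K) ≠ 0) {ξ κ : K} (hξ : σ ξ = -ξ) (hκ : σ κ = κ) {m : GL (Fin 3) K}
    (hm : (m : Matrix (Fin 3) (Fin 3) K) = !![1, κ * ξ, κ ^ 2 * ξ ^ 2 / 2; 0, 1, κ * ξ; 0, 0, 1]) :
    m ∈ unitaryGroupOfForm σ ((StdForm.antidiagonal 3).over K) := by
  refine (mem_unitaryGroupOfForm_iff_of_coe_eq_upperUnipotent σ hσ hm).2 ⟨?_, ?_⟩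
  · rw [map_mul, hκ, hξ]; ring
  · have h22 : (2 : K)⁻¹ * 2 = 1 := inv_mul_cancel₀ h2
    rw [map_div₀, map_mul, map_pow, map_pow, map_ofNat, map_mul, hκ, hξ]
    linear_combination (κ ^ 2 * ξ ^ 2) * h22

/-- **ONE-PARAMETER SUBGROUP: `m_κ · m_{κ′} = m_{κ + κ′}`** (`2 ∈ K^×`). [cite: Rogawski1990, §1.10 p. 9] -/
theorem coe_transversal_mul (h2 : (2 : K) ≠ 0) {ξ κ κ' : K} {m m' : GL (Fin 3) K}
    (hm : (m : Matrix (Fin 3) (Fin 3) K) = !![1, κ * ξ, κ ^ 2 * ξ ^ 2 / 2; 0, 1, κ * ξ; 0, 0, 1])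
    (hm' : (m' : Matrix (Fin 3) (Fin 3) K) = !![1, κ' * ξ, κ' ^ 2 * ξ ^ 2 / 2; 0, 1, κ' * ξ; 0, 0, 1]) :
    ((m * m' : GL (Fin 3) K) : Matrix (Fin 3) (Fin 3) K) = !![1, (κ + κ') * ξ, (κ + κ') ^ 2 * ξ ^ 2 / 2; 0, 1, (κ + κ') * ξ; 0, 0, 1] := by
  have h22 : (2 : K)⁻¹ * 2 = 1 := inv_mul_cancel₀ h2
  have e01 : κ * ξ + κ' * ξ = (κ + κ') * ξ := by ring
  have e02 : κ ^ 2 * ξ ^ 2 / 2 + κ' ^ 2 * ξ ^ 2 / 2 + κ * ξ * (κ' * ξ) = (κ + κ') ^ 2 * ξ ^ 2 / 2 := by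
    linear_combination (-(κ * κ' * ξ ^ 2)) * h22
  rw [coe_upperTriangularUnipotent_mul hm hm', e01, e02]

/-- **`m_κ⁻¹ = m_{−κ}`**. [cite: Rogawski1990, §1.10 p. 9] -/
theorem coe_transversal_inv (h2 : (2 : K) ≠ 0) {ξ κ : K} {m : GL (Fin 3) K}
    (hm : (m : Matrix (Fin 3) (Fin 3) K) = !![1, κ * ξ, κ ^ 2 * ξ ^ 2 / 2; 0, 1, κ * ξ; 0, 0, 1]) :
    ((m⁻¹ : GL (Fin 3) K) : Matrix (Fin 3) (Fin 3) K) = !![1, (-κ) * ξ, (-κ) ^ 2 * ξ ^ 2 / 2; 0, 1, (-κ) * ξ; 0, 0, 1] := by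
  have h22 : (2 : K)⁻¹ * 2 = 1 := inv_mul_cancel₀ h2
  have e01 : -(κ * ξ) = (-κ) * ξ := by ring
  have e02 : κ * ξ * (κ * ξ) - κ ^ 2 * ξ ^ 2 / 2 = (-κ) ^ 2 * ξ ^ 2 / 2 := by linear_combination (-(κ ^ 2 * ξ ^ 2)) * h22
  rw [coe_upperTriangularUnipotent_inv hm, e01, e02]

/-- **THE COMMUTATOR COORDINATE: `m_κ u₀ m_κ⁻¹ = !![1, 1, −t₀ − 2κξ; 0, 1, −1; 0, 0, 1]`** — conjugation by the transversal moves the base point along its class by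
`−2κξ` in the corner (★ `coe_upperTriangularUnipotent_conj`). [cite: Rogawski1990, §3.9 p. 32] -/
theorem coe_transversal_conj_regularUnipotent {ξ κ t₀ : K} {m u : GL (Fin 3) K}
    (hm : (m : Matrix (Fin 3) (Fin 3) K) = !![1, κ * ξ, κ ^ 2 * ξ ^ 2 / 2; 0, 1, κ * ξ; 0, 0, 1])
    (hu : (u : Matrix (Fin 3) (Fin 3) K) = !![1, 1, -t₀; 0, 1, -1; 0, 0, 1]) :
    ((m * u * m⁻¹ : GL (Fin 3) K) : Matrix (Fin 3) (Fin 3) K) = !![1, 1, -t₀ - 2 * κ * ξ; 0, 1, -1; 0, 0, 1] := by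
  have hm' := coe_upperTriangularUnipotent_inv hm
  have hm'' : ((m⁻¹ : GL (Fin 3) K) : Matrix (Fin 3) (Fin 3) K) = !![1, -(κ * ξ), κ * ξ * (κ * ξ) - κ ^ 2 * ξ ^ 2 / 2; 0, 1, -(κ * ξ); 0, 0, 1] := hm'
  have e02 : -t₀ + κ * ξ * -1 - 1 * (κ * ξ) = -t₀ - 2 * κ * ξ := by ring
  rw [coe_upperTriangularUnipotent_conj hm hm'' hu, e02]

/-- **`m_κ n(a, s) m_κ⁻¹ = n(a, s − 2κξa)`** — the transversal acts on the centraliser by a CENTRAL shift of the `s`-coordinate (the commutator `[m_κ, n(a,s)]` lies in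
`Z(N)`). [cite: Rogawski1990, §3.9 p. 32] -/
theorem coe_transversal_conj_regCentElt {ξ κ a s : K} {m g : GL (Fin 3) K}
    (hm : (m : Matrix (Fin 3) (Fin 3) K) = !![1, κ * ξ, κ ^ 2 * ξ ^ 2 / 2; 0, 1, κ * ξ; 0, 0, 1])
    (hg : (g : Matrix (Fin 3) (Fin 3) K) = !![1, a, s - a ^ 2 / 2; 0, 1, -a; 0, 0, 1]) :
    ((m * g * m⁻¹ : GL (Fin 3) K) : Matrix (Fin 3) (Fin 3) K) = !![1, a, (s - 2 * κ * ξ * a) - a ^ 2 / 2; 0, 1, -a; 0, 0, 1] := by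
  have hm' := coe_upperTriangularUnipotent_inv hm
  have hm'' : ((m⁻¹ : GL (Fin 3) K) : Matrix (Fin 3) (Fin 3) K) = !![1, -(κ * ξ), κ * ξ * (κ * ξ) - κ ^ 2 * ξ ^ 2 / 2; 0, 1, -(κ * ξ); 0, 0, 1] := hm'
  have e02 : s - a ^ 2 / 2 + κ * ξ * -a - a * (κ * ξ) = (s - 2 * κ * ξ * a) - a ^ 2 / 2 := by ring
  rw [coe_upperTriangularUnipotent_conj hm hm'' hg, e02]

/-- **THE DECOMPOSITION `U ∩ N = M · C_{U∩N}(u₀)`**: every unitriangular `g = !![1, x, y; 0, 1, w; 0, 0, 1] ∈ U` is `m_κ · n(a, s)` with `κξ = (x − σx)∕2`, `a = (x + σx)∕2`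
and some `s` with `σs = −s` (`σ` an involution, `2 ∈ K^×`, `ξ ∈ K^×` with `σξ = −ξ`).  [cite: Rogawski1990, §1.10 p. 9; §3.9 p. 32] -/
theorem exists_transversal_mul_regCent_of_mem (hσ : ∀ z : K, σ (σ z) = z) (h2 : (2 : K) ≠ 0) {ξ : K} (hξ : σ ξ = -ξ) (hξ0 : ξ ≠ 0)
    {x y w : K} {g : GL (Fin 3) K} (hg : (g : Matrix (Fin 3) (Fin 3) K) = !![1, x, y; 0, 1, w; 0, 0, 1])
    (hU : g ∈ unitaryGroupOfForm σ ((StdForm.antidiagonal 3).over K)) :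
    ∃ (m n : GL (Fin 3) K) (κ a s : K), σ κ = κ ∧ σ a = a ∧ σ s = -s ∧ κ * ξ = (x - σ x) / 2 ∧ a = (x + σ x) / 2 ∧
      (m : Matrix (Fin 3) (Fin 3) K) = !![1, κ * ξ, κ ^ 2 * ξ ^ 2 / 2; 0, 1, κ * ξ; 0, 0, 1] ∧
      (n : Matrix (Fin 3) (Fin 3) K) = !![1, a, s - a ^ 2 / 2; 0, 1, -a; 0, 0, 1] ∧ g = m * n := by
  obtain ⟨hw, hy⟩ := (mem_unitaryGroupOfForm_iff_of_coe_eq_upperUnipotent σ hσ hg).1 hU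
  set κ : K := (x - σ x) / (2 * ξ) with hκ
  set a : K := (x + σ x) / 2 with ha
  have hσκ : σ κ = κ := by
    rw [hκ, map_div₀, map_sub, hσ, map_mul, map_ofNat, hξ]; field_simp; ring
  have hσa : σ a = a := by rw [ha, map_div₀, map_add, hσ, map_ofNat, add_comm]
  have hκξ : κ * ξ = (x - σ x) / 2 := by rw [hκ]; field_simp
  have hxdec : x = a + κ * ξ := by rw [hκξ, ha]; field_simp; ring
  obtain ⟨m, hm, hm'⟩ := exists_units_coe_eq_upperTriangularUnipotent (κ * ξ) (κ ^ 2 * ξ ^ 2 / 2) (κ * ξ)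
  -- `n := m⁻¹ g`, computed entrywise
  have hσx : σ x = a - κ * ξ := by rw [hxdec, map_add, map_mul, hσa, hσκ, hξ]; ring
  set s : K := κ * ξ * (κ * ξ) - κ ^ 2 * ξ ^ 2 / 2 + y + -(κ * ξ) * w + a ^ 2 / 2 with hs
  have e01 : -(κ * ξ) + x = a := by rw [hxdec]; ring
  have e12 : -(κ * ξ) + w = -a := by rw [hw, hσx]; ring
  have e02 : κ * ξ * (κ * ξ) - κ ^ 2 * ξ ^ 2 / 2 + y + -(κ * ξ) * w = s - a ^ 2 / 2 := by rw [hs]; ring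
  have hn : (((m⁻¹ * g : GL (Fin 3) K)) : Matrix (Fin 3) (Fin 3) K) = !![1, a, s - a ^ 2 / 2; 0, 1, -a; 0, 0, 1] := by
    rw [coe_upperTriangularUnipotent_mul hm' hg, e01, e12, e02]
  refine ⟨m, m⁻¹ * g, κ, a, s, hσκ, hσa, ?_, hκξ, rfl, hm, hn, by rw [mul_inv_cancel_left]⟩
  -- `σ s = −s`: unitarity of `n = m⁻¹ g` with σ-fixed first coordinate
  have hmU : m ∈ unitaryGroupOfForm σ ((StdForm.antidiagonal 3).over K) := transversal_mem σ hσ h2 hξ hσκ hm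
  have hnU : m⁻¹ * g ∈ unitaryGroupOfForm σ ((StdForm.antidiagonal 3).over K) := mul_mem (inv_mem hmU) hU
  obtain ⟨-, hb⟩ := (mem_unitaryGroupOfForm_iff_of_coe_eq_upperUnipotent σ hσ hn).1 hnU
  rw [map_sub, map_div₀, map_pow, map_ofNat, hσa] at hb
  have h22 : (2 : K)⁻¹ * 2 = 1 := inv_mul_cancel₀ h2
  linear_combination hb + (a ^ 2) * h22

end Transversal

/-! ## §4 Torus scaling: integer powers of `d(z) = diag(z, 1, (σz)⁻¹)` and diagonal conjugation of unitriangular elements -/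

section Torus

/-- **Diagonal conjugation of a unitriangular element**: `diag(p,q,r)·!![1,x,y;0,1,w;0,0,1]·diag(p,q,r)⁻¹ = !![1, p x q⁻¹, p y r⁻¹; 0, 1, q w r⁻¹; 0, 0, 1]` — the COVERING
ENTRY FORMULA of the unfolding: for `t = diag(h, e, (σh)⁻¹) ∈ T` and `m_κ u₀ m_κ⁻¹`, the entries `h e⁻¹` and `h·σh·(−t₀ − 2κξ)` that the compactness of `K C K` bounds.
[cite: Rogawski1990, §3.9 p. 32] -/
theorem coe_diagonal_conj_upperTriangularUnipotent {p q r x y w : K} (hp : p ≠ 0) (hq : q ≠ 0) (hr : r ≠ 0) {t g : GL (Fin 3) K}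
    (ht : (t : Matrix (Fin 3) (Fin 3) K) = Matrix.diagonal ![p, q, r]) (hg : (g : Matrix (Fin 3) (Fin 3) K) = !![1, x, y; 0, 1, w; 0, 0, 1]) :
    ((t * g * t⁻¹ : GL (Fin 3) K) : Matrix (Fin 3) (Fin 3) K) = !![1, p * x * q⁻¹, p * y * r⁻¹; 0, 1, q * w * r⁻¹; 0, 0, 1] := by
  have ht' : ((t⁻¹ : GL (Fin 3) K) : Matrix (Fin 3) (Fin 3) K) = Matrix.diagonal ![p⁻¹, q⁻¹, r⁻¹] := by
    have h1 : (t : Matrix (Fin 3) (Fin 3) K) * Matrix.diagonal ![p⁻¹, q⁻¹, r⁻¹] = 1 := by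
      rw [ht, Matrix.diagonal_mul_diagonal, ← Matrix.diagonal_one]
      congr 1; funext i; fin_cases i <;> simp [mul_inv_cancel₀ hp, mul_inv_cancel₀ hq, mul_inv_cancel₀ hr]
    rw [Matrix.coe_units_inv]
    exact Matrix.inv_eq_right_inv h1
  rw [Units.val_mul, Units.val_mul, ht, hg, ht']
  ext i j
  fin_cases i <;> fin_cases j <;> simp [Matrix.mul_apply, Matrix.diagonal, hp, hq, hr]

/-- **Integer powers of the torus element**: if `(d : M₃) = diag(z, 1, (σz)⁻¹)` with `z ≠ 0`, then `(d^j : M₃) = diag(z^j, 1, ((σz)^j)⁻¹)` for every `j : ℤ`.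
[cite: Rogawski1990, §1.10 p. 9] -/
theorem coe_torusElt_zpow {z : K} (hz : z ≠ 0) {d : GL (Fin 3) K} (hd : (d : Matrix (Fin 3) (Fin 3) K) = Matrix.diagonal ![z, 1, (σ z)⁻¹]) (j : ℤ) :
    ((d ^ j : GL (Fin 3) K) : Matrix (Fin 3) (Fin 3) K) = Matrix.diagonal ![z ^ j, 1, ((σ z) ^ j)⁻¹] := by
  have hσz : σ z ≠ 0 := (map_ne_zero σ).2 hz
  have hd' : ((d⁻¹ : GL (Fin 3) K) : Matrix (Fin 3) (Fin 3) K) = Matrix.diagonal ![z⁻¹, 1, σ z] := by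
    have h1 : (d : Matrix (Fin 3) (Fin 3) K) * Matrix.diagonal ![z⁻¹, 1, σ z] = 1 := by
      rw [hd, Matrix.diagonal_mul_diagonal, ← Matrix.diagonal_one]
      congr 1; funext i; fin_cases i <;> simp [mul_inv_cancel₀ hz, inv_mul_cancel₀ hσz]
    rw [Matrix.coe_units_inv]
    exact Matrix.inv_eq_right_inv h1
  cases j with
  | ofNat k =>
    rw [Int.ofNat_eq_natCast, zpow_natCast, zpow_natCast, zpow_natCast, Units.val_pow_eq_pow_val, hd, Matrix.diagonal_pow]
    congr 1; funext i; fin_cases i <;> simp [inv_pow]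
  | negSucc k =>
    rw [zpow_negSucc, zpow_negSucc, zpow_negSucc, ← inv_pow, Units.val_pow_eq_pow_val, hd', Matrix.diagonal_pow]
    congr 1; funext i; fin_cases i <;> simp [inv_pow, inv_inv]

/-- **Torus scaling of a unitriangular element by `d(z)^j`**: `d^j·!![1,x,y;0,1,w;0,0,1]·d^{−j} = !![1, z^j x, (zσz)^j y; 0, 1, (σz)^j w; 0, 0, 1]` (`j : ℤ`).
[cite: Rogawski1990, §3.9 p. 32] -/
theorem coe_torusElt_zpow_conj_upperTriangularUnipotent {z x y w : K} (hz : z ≠ 0) {d g : GL (Fin 3) K}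
    (hd : (d : Matrix (Fin 3) (Fin 3) K) = Matrix.diagonal ![z, 1, (σ z)⁻¹]) (hg : (g : Matrix (Fin 3) (Fin 3) K) = !![1, x, y; 0, 1, w; 0, 0, 1]) (j : ℤ) :
    ((d ^ j * g * (d ^ j)⁻¹ : GL (Fin 3) K) : Matrix (Fin 3) (Fin 3) K) = !![1, z ^ j * x, (z * σ z) ^ j * y; 0, 1, (σ z) ^ j * w; 0, 0, 1] := by
  have hσz : σ z ≠ 0 := (map_ne_zero σ).2 hz
  have hzj : z ^ j ≠ 0 := zpow_ne_zero j hz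
  have hσzj : (σ z) ^ j ≠ 0 := zpow_ne_zero j hσz
  rw [coe_diagonal_conj_upperTriangularUnipotent hzj one_ne_zero (inv_ne_zero hσzj) (coe_torusElt_zpow σ hz hd j) hg]
  have e01 : z ^ j * x * (1 : K)⁻¹ = z ^ j * x := by rw [inv_one, mul_one]
  have e02 : z ^ j * y * ((σ z) ^ j)⁻¹⁻¹ = (z * σ z) ^ j * y := by rw [inv_inv, mul_zpow]; ring
  have e12 : (1 : K) * w * ((σ z) ^ j)⁻¹⁻¹ = (σ z) ^ j * w := by rw [inv_inv]; ring
  rw [e01, e02, e12]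

end Torus

/-! ## §5 Valued part: integrality of unitriangular elements, ABSORPTION, COSET CRITERION, and the ball subgroups `S_r` -/

section Valued

open Literature.NumberTheory.Automorphic.UnitaryLatticeTree

variable [Valued K ℤᵐ⁰]

/-- **Integrality of a unitriangular matrix by its three entries.** [cite: Rogawski1990, §4.9 p. 54] -/
theorem isIntMatrix_upperTriangularUnipotent_iff {x y w : K} {g : GL (Fin 3) K} (hg : (g : Matrix (Fin 3) (Fin 3) K) = !![1, x, y; 0, 1, w; 0, 0, 1]) :
    IsIntMatrix (g : Matrix (Fin 3) (Fin 3) K) ↔ Valued.v x ≤ 1 ∧ Valued.v y ≤ 1 ∧ Valued.v w ≤ 1 := by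
  rw [hg]
  constructor
  · intro h
    exact ⟨by simpa using h 0 1, by simpa using h 0 2, by simpa using h 1 2⟩
  · rintro ⟨hx, hy, hw⟩ i j
    fin_cases i <;> fin_cases j <;> simp [hx, hy, hw]

/-- **The inverse of an integral unitriangular matrix is integral** (entries `−x`, `xw − y`, `−w`). [cite: Rogawski1990, §4.9 p. 54] -/
theorem isIntMatrix_inv_of_upperTriangularUnipotent {x y w : K} {g : GL (Fin 3) K} (hg : (g : Matrix (Fin 3) (Fin 3) K) = !![1, x, y; 0, 1, w; 0, 0, 1])
    (hx : Valued.v x ≤ 1) (hy : Valued.v y ≤ 1) (hw : Valued.v w ≤ 1) :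
    IsIntMatrix (((g⁻¹ : GL (Fin 3) K)) : Matrix (Fin 3) (Fin 3) K) := by
  rw [isIntMatrix_upperTriangularUnipotent_iff (coe_upperTriangularUnipotent_inv hg)]
  refine ⟨by rwa [Valuation.map_neg], ?_, by rwa [Valuation.map_neg]⟩
  refine (Valuation.map_sub _ _ _).trans (max_le ?_ hy)
  rw [Valuation.map_mul, ← mul_one (1 : ℤᵐ⁰)]
  exact mul_le_mul' hx hw

/-- **ABSORPTION** (the inclusion `W_j · S_j ⊆ W_j` of the unfolding, entrywise): `σ` isometric, `v 2 = 1`, `v z = exp(−1)`, `0 ≤ j`; for `κ, a, s` with `v a ≤ 1`,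
`v s ≤ exp(2j)`, `v (κξ) ≤ exp(2j)`: the element `d^j · (m_κ · n(a,s) · m_κ⁻¹) · d^{−j}` — `= !![1, z^j a, (zσz)^j (s − 2κξa − a²∕2); 0, 1, −(σz)^j a; 0, 0, 1]` — is INTEGRAL
together with its inverse. [cite: Rogawski1990, §8.1 p. 112] [cite: Rao1972, Theorem] -/
theorem isIntMatrix_torusZpow_conj_transversal_conj_regCent (hσv : ∀ x : K, Valued.v (σ x) = Valued.v x) (hv2 : Valued.v (2 : K) = 1)
    {z ξ κ a s : K} (hz : Valued.v z = WithZero.exp (-1 : ℤ)) {j : ℤ} (hj : 0 ≤ j)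
    (ha : Valued.v a ≤ 1) (hs : Valued.v s ≤ WithZero.exp (2 * j)) (hκ : Valued.v (κ * ξ) ≤ WithZero.exp (2 * j))
    {d m g : GL (Fin 3) K} (hd : (d : Matrix (Fin 3) (Fin 3) K) = Matrix.diagonal ![z, 1, (σ z)⁻¹])
    (hm : (m : Matrix (Fin 3) (Fin 3) K) = !![1, κ * ξ, κ ^ 2 * ξ ^ 2 / 2; 0, 1, κ * ξ; 0, 0, 1])
    (hg : (g : Matrix (Fin 3) (Fin 3) K) = !![1, a, s - a ^ 2 / 2; 0, 1, -a; 0, 0, 1]) :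
    IsIntMatrix ((d ^ j * (m * g * m⁻¹) * (d ^ j)⁻¹ : GL (Fin 3) K) : Matrix (Fin 3) (Fin 3) K) ∧
      IsIntMatrix ((((d ^ j * (m * g * m⁻¹) * (d ^ j)⁻¹)⁻¹ : GL (Fin 3) K)) : Matrix (Fin 3) (Fin 3) K) := by
  have hz0 : z ≠ 0 := (Valuation.ne_zero_iff _).1 (by rw [hz]; exact WithZero.coe_ne_zero)
  have hconj := coe_torusElt_zpow_conj_upperTriangularUnipotent σ hz0 hd (coe_transversal_conj_regCentElt hm hg) j
  -- the three valuations
  have hvz : Valued.v (z ^ j) = WithZero.exp (-j) := by rw [map_zpow₀, hz, ← WithZero.exp_zsmul]; congr 1; ring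
  have hvσz : Valued.v ((σ z) ^ j) = WithZero.exp (-j) := by rw [map_zpow₀, hσv, hz, ← WithZero.exp_zsmul]; congr 1; ring
  have hvN : Valued.v ((z * σ z) ^ j) = WithZero.exp (-(2 * j)) := by
    rw [map_zpow₀, Valuation.map_mul, hσv, hz, ← WithZero.exp_add, ← WithZero.exp_zsmul]; congr 1; ring
  have h01 : Valued.v (z ^ j * a) ≤ 1 := by
    rw [Valuation.map_mul, hvz, ← mul_one (1 : ℤᵐ⁰)]
    refine mul_le_mul' ?_ ha
    rw [← WithZero.exp_zero]; exact WithZero.exp_le_exp.2 (by omega)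
  have h12 : Valued.v ((σ z) ^ j * -a) ≤ 1 := by
    rw [Valuation.map_mul, Valuation.map_neg, hvσz, ← mul_one (1 : ℤᵐ⁰)]
    refine mul_le_mul' ?_ ha
    rw [← WithZero.exp_zero]; exact WithZero.exp_le_exp.2 (by omega)
  have h02 : Valued.v ((z * σ z) ^ j * ((s - 2 * κ * ξ * a) - a ^ 2 / 2)) ≤ 1 := by
    have hinner : Valued.v ((s - 2 * κ * ξ * a) - a ^ 2 / 2) ≤ WithZero.exp (2 * j) := by
      have h2j : (1 : ℤᵐ⁰) ≤ WithZero.exp (2 * j) := by rw [← WithZero.exp_zero]; exact WithZero.exp_le_exp.2 (by omega)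
      refine (Valuation.map_sub _ _ _).trans (max_le ((Valuation.map_sub _ _ _).trans (max_le hs ?_)) ?_)
      · rw [show 2 * κ * ξ * a = 2 * (κ * ξ) * a by ring, Valuation.map_mul, Valuation.map_mul, hv2, one_mul, ← mul_one (WithZero.exp (2 * j))]
        exact mul_le_mul' hκ ha
      · rw [map_div₀, hv2, div_one, Valuation.map_pow]
        exact (pow_le_one₀ zero_le ha).trans h2j
    rw [Valuation.map_mul, hvN]
    calc WithZero.exp (-(2 * j)) * Valued.v ((s - 2 * κ * ξ * a) - a ^ 2 / 2)
        ≤ WithZero.exp (-(2 * j)) * WithZero.exp (2 * j) := mul_le_mul' le_rfl hinner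
      _ = 1 := by rw [← WithZero.exp_add, neg_add_cancel, WithZero.exp_zero]
  exact ⟨(isIntMatrix_upperTriangularUnipotent_iff hconj).2 ⟨h01, h02, h12⟩, isIntMatrix_inv_of_upperTriangularUnipotent hconj h01 h02 h12⟩

/-- **COSET CRITERION**: `d^j · m_κ · d^{−j}` (`= !![1, z^j κξ, (zσz)^j κ²ξ²∕2; 0, 1, (σz)^j κξ; 0, 0, 1]`) is INTEGRAL iff `v (z^j κξ) ≤ 1` (`σ` isometric, `v 2 = 1`); so
`K d^j m_κ = K d^j m_{κ′}` as soon as `v (z^j (κ − κ′) ξ) ≤ 1` — the `K d^j`-cosets of the transversal `M_j` are counted by a ball quotient of the `κ`-line.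
[cite: Rogawski1990, §8.1 p. 112] [cite: Rao1972, Theorem] -/
theorem isIntMatrix_torusZpow_conj_transversal_iff (hσv : ∀ x : K, Valued.v (σ x) = Valued.v x) (hv2 : Valued.v (2 : K) = 1)
    {z ξ κ : K} (hz0 : z ≠ 0) (j : ℤ) {d m : GL (Fin 3) K} (hd : (d : Matrix (Fin 3) (Fin 3) K) = Matrix.diagonal ![z, 1, (σ z)⁻¹])
    (hm : (m : Matrix (Fin 3) (Fin 3) K) = !![1, κ * ξ, κ ^ 2 * ξ ^ 2 / 2; 0, 1, κ * ξ; 0, 0, 1]) :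
    IsIntMatrix ((d ^ j * m * (d ^ j)⁻¹ : GL (Fin 3) K) : Matrix (Fin 3) (Fin 3) K) ↔ Valued.v (z ^ j * (κ * ξ)) ≤ 1 := by
  have hconj := coe_torusElt_zpow_conj_upperTriangularUnipotent σ hz0 hd hm j
  have hvσ : Valued.v ((σ z) ^ j * (κ * ξ)) = Valued.v (z ^ j * (κ * ξ)) := by simp only [Valuation.map_mul, map_zpow₀, hσv]
  have hcorner : Valued.v ((z * σ z) ^ j * (κ ^ 2 * ξ ^ 2 / 2)) = Valued.v (z ^ j * (κ * ξ)) * Valued.v (z ^ j * (κ * ξ)) := by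
    rw [show (z * σ z) ^ j * (κ ^ 2 * ξ ^ 2 / 2) = (z ^ j * (κ * ξ)) * ((σ z) ^ j * (κ * ξ)) / 2 by rw [mul_zpow]; ring, map_div₀, hv2, div_one,
      Valuation.map_mul, hvσ]
  rw [isIntMatrix_upperTriangularUnipotent_iff hconj, hvσ, hcorner]
  constructor
  · rintro ⟨h, -, -⟩; exact h
  · intro h
    refine ⟨h, ?_, h⟩
    rw [← mul_one (1 : ℤᵐ⁰)]
    exact mul_le_mul' h h

/-- **THE BALL SUBGROUPS `S_r` of the centraliser** (`2 ∈ K^×`, `σ` isometric): for every radius `r`, the elements `n(a, s)` with `σa = a`, `σs = −s`, `v a ≤ 1`, `v s ≤ r` form a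
SUBGROUP of `GL₃(K)` (additivity of the coordinates + the ultrametric inequality) — stated existentially (no `def`); every member lies in `U` and commutes with `u₀`
(`regCentElt_mem_and_commute`). [cite: Rogawski1990, §8.1 p. 112] [cite: Rao1972, Theorem] -/
theorem exists_subgroup_regCentBall (h2 : (2 : K) ≠ 0) (r : ℤᵐ⁰) :
    ∃ S : Subgroup (GL (Fin 3) K), ∀ g : GL (Fin 3) K, g ∈ S ↔
      ∃ a s : K, σ a = a ∧ σ s = -s ∧ Valued.v a ≤ 1 ∧ Valued.v s ≤ r ∧ (g : Matrix (Fin 3) (Fin 3) K) = !![1, a, s - a ^ 2 / 2; 0, 1, -a; 0, 0, 1] := by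
  refine ⟨{ carrier := {g | ∃ a s : K, σ a = a ∧ σ s = -s ∧ Valued.v a ≤ 1 ∧ Valued.v s ≤ r ∧
      (g : Matrix (Fin 3) (Fin 3) K) = !![1, a, s - a ^ 2 / 2; 0, 1, -a; 0, 0, 1]}, mul_mem' := ?_, one_mem' := ?_, inv_mem' := ?_ }, fun g => Iff.rfl⟩
  · rintro g g' ⟨a, s, ha, hs, hva, hvs, hg⟩ ⟨a', s', ha', hs', hva', hvs', hg'⟩
    refine ⟨a + a', s + s', by rw [map_add, ha, ha'], by rw [map_add, hs, hs', neg_add], ?_, ?_, coe_regCentElt_mul h2 hg hg'⟩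
    · exact (Valuation.map_add _ _ _).trans (max_le hva hva')
    · exact (Valuation.map_add _ _ _).trans (max_le hvs hvs')
  · refine ⟨0, 0, map_zero σ, by rw [map_zero, neg_zero], by rw [map_zero]; exact zero_le, by rw [map_zero]; exact zero_le, ?_⟩
    rw [Units.val_one]
    ext i j; fin_cases i <;> fin_cases j <;> simp
  · rintro g ⟨a, s, ha, hs, hva, hvs, hg⟩
    refine ⟨-a, -s, by rw [map_neg, ha], by rw [map_neg, hs, neg_neg], by rwa [Valuation.map_neg], by rwa [Valuation.map_neg], ?_⟩
    rw [coe_regCentElt_inv h2 hg]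

/-- **(v) THE INDEX OF THE BALL SUBGROUPS IS A BALL INDEX ON THE `s`-LINE (ED. 2).**  For radii `r, r′` (no order hypothesis needed: both sides are relative indices) and the ball subgroups `S_r`, `S_{r′}` of the centraliser
(given by their membership predicates, cf. `exists_subgroup_regCentBall`): `[S_{r′} : S_r] = [{s : σs = −s, v s ≤ r′} : {s : σs = −s, v s ≤ r}]` — the coordinate `s`
(`= g₀₂ + g₀₁²∕2`) is a homomorphism onto the anti-invariant line (additivity `coe_regCentElt_mul`), its fibre condition is the `a`-ball, common to both.  With ★
`measure_subgroup_eq_relIndex_mul_of_isCompact` (`SubgroupRelIndexMeasure`) this gives `ρ(S_{r′}) = [B_{r′} : B_r] · ρ(S_r)`, and the numeric value of the ball index is ★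
`relIndex_leAddSubgroup_exp` (`SubgroupIndexDevissage`) after rescaling the line `{σ s = −s} = ξ · K^σ`. [cite: Rogawski1990, §8.1 p. 112] [cite: Rao1972, Theorem] -/
theorem relIndex_regCentBall_eq (h2 : (2 : K) ≠ 0) {r r' : ℤᵐ⁰} {S S' : Subgroup (GL (Fin 3) K)}
    (hS : ∀ g : GL (Fin 3) K, g ∈ S ↔
      ∃ a s : K, σ a = a ∧ σ s = -s ∧ Valued.v a ≤ 1 ∧ Valued.v s ≤ r ∧ (g : Matrix (Fin 3) (Fin 3) K) = !![1, a, s - a ^ 2 / 2; 0, 1, -a; 0, 0, 1])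
    (hS' : ∀ g : GL (Fin 3) K, g ∈ S' ↔
      ∃ a s : K, σ a = a ∧ σ s = -s ∧ Valued.v a ≤ 1 ∧ Valued.v s ≤ r' ∧ (g : Matrix (Fin 3) (Fin 3) K) = !![1, a, s - a ^ 2 / 2; 0, 1, -a; 0, 0, 1]) :
    S.relIndex S' =
      ((Valued.v : Valuation K ℤᵐ⁰).leAddSubgroup r ⊓ (AddMonoidHom.id K + (σ : K →+* K).toAddMonoidHom).ker).relIndex
        ((Valued.v : Valuation K ℤᵐ⁰).leAddSubgroup r' ⊓ (AddMonoidHom.id K + (σ : K →+* K).toAddMonoidHom).ker) := by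
  classical
  -- the `s`-coordinate `g₀₂ + g₀₁² ∕ 2` and how it reads on `n(a, s)`
  have hcoord : ∀ {g : GL (Fin 3) K} {a s : K}, (g : Matrix (Fin 3) (Fin 3) K) = !![1, a, s - a ^ 2 / 2; 0, 1, -a; 0, 0, 1] →
      (g : Matrix (Fin 3) (Fin 3) K) 0 2 + (g : Matrix (Fin 3) (Fin 3) K) 0 1 ^ 2 / 2 = s := by
    intro g a s hg
    rw [hg]; simp
  -- the coordinate as a homomorphism `↥S' →* Multiplicative K`
  let φ : ↥S' →* Multiplicative K :=
    { toFun := fun g => Multiplicative.ofAdd (((g : GL (Fin 3) K) : Matrix (Fin 3) (Fin 3) K) 0 2 + ((g : GL (Fin 3) K) : Matrix (Fin 3) (Fin 3) K) 0 1 ^ 2 / 2)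
      map_one' := by
        rw [OneMemClass.coe_one, Units.val_one]
        simp
      map_mul' := by
        intro g g'
        obtain ⟨a, s, -, -, -, -, hg⟩ := (hS' g).1 g.2
        obtain ⟨a', s', -, -, -, -, hg'⟩ := (hS' g').1 g'.2
        have hgg' := coe_regCentElt_mul h2 hg hg'
        rw [← ofAdd_add, Subgroup.coe_mul, hcoord hgg', hcoord hg, hcoord hg'] }
  have hφ : ∀ (g : ↥S') {a s : K}, ((g : GL (Fin 3) K) : Matrix (Fin 3) (Fin 3) K) = !![1, a, s - a ^ 2 / 2; 0, 1, -a; 0, 0, 1] →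
      φ g = Multiplicative.ofAdd s := fun g a s hg => by
    show Multiplicative.ofAdd _ = _
    rw [hcoord hg]
  -- the range of `φ` is the ball `B_{r′}` of the anti-invariant line
  have hrange : φ.range = AddSubgroup.toSubgroup
      ((Valued.v : Valuation K ℤᵐ⁰).leAddSubgroup r' ⊓ (AddMonoidHom.id K + (σ : K →+* K).toAddMonoidHom).ker) := by
    ext y
    rw [MonoidHom.mem_range]
    change _ ↔ Multiplicative.toAdd y ∈ ((Valued.v : Valuation K ℤᵐ⁰).leAddSubgroup r' ⊓ (AddMonoidHom.id K + (σ : K →+* K).toAddMonoidHom).ker)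
    rw [AddSubgroup.mem_inf, Valuation.mem_leAddSubgroup_iff, AddMonoidHom.mem_ker]
    constructor
    · rintro ⟨g, rfl⟩
      obtain ⟨a, s, -, hs, -, hvs, hg⟩ := (hS' g).1 g.2
      rw [hφ g hg, toAdd_ofAdd]
      exact ⟨hvs, by simp [hs]⟩
    · rintro ⟨hvy, hσy⟩
      have hσy' : σ (Multiplicative.toAdd y) = -Multiplicative.toAdd y := by
        have h : Multiplicative.toAdd y + σ (Multiplicative.toAdd y) = 0 := by simpa using hσy
        linear_combination h
      obtain ⟨n, hn, -⟩ := exists_units_coe_eq_upperTriangularUnipotent (0 : K) (Multiplicative.toAdd y - (0 : K) ^ 2 / 2) (-0)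
      have hnS' : n ∈ S' := (hS' n).2 ⟨0, Multiplicative.toAdd y, map_zero σ, hσy', by rw [map_zero]; exact zero_le, hvy, hn⟩
      exact ⟨⟨n, hnS'⟩, by rw [hφ ⟨n, hnS'⟩ hn, ofAdd_toAdd]⟩
  -- `S` inside `S'` is the preimage of the ball `B_r`
  have hcomap : S.subgroupOf S' = (AddSubgroup.toSubgroup ((Valued.v : Valuation K ℤᵐ⁰).leAddSubgroup r)).comap φ := by
    ext g
    rw [Subgroup.mem_subgroupOf, Subgroup.mem_comap]
    change _ ↔ Multiplicative.toAdd (φ g) ∈ (Valued.v : Valuation K ℤᵐ⁰).leAddSubgroup r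
    rw [Valuation.mem_leAddSubgroup_iff]
    obtain ⟨a, s, ha, hs, hva, hvs, hg⟩ := (hS' g).1 g.2
    rw [hφ g hg, toAdd_ofAdd]
    constructor
    · intro hgS
      obtain ⟨a₁, s₁, -, -, -, hvs₁, hg₁⟩ := (hS (g : GL (Fin 3) K)).1 hgS
      have : s₁ = s := by rw [← hcoord hg₁, hcoord hg]
      rwa [← this]
    · intro hvsr
      exact (hS (g : GL (Fin 3) K)).2 ⟨a, s, ha, hs, hva, hvsr, hg⟩
  -- assemble
  rw [Subgroup.relIndex, hcomap, Subgroup.index_comap, hrange, AddSubgroup.relIndex_toSubgroup]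
  -- `B_r ⊓ (B_{r′} ⊓ L) = (B_r ⊓ L) ⊓ (B_{r′} ⊓ L)` for `r ≤ r′`
  rw [← AddSubgroup.inf_relIndex_right ((Valued.v : Valuation K ℤᵐ⁰).leAddSubgroup r),
    ← AddSubgroup.inf_relIndex_right ((Valued.v : Valuation K ℤᵐ⁰).leAddSubgroup r ⊓ (AddMonoidHom.id K + (σ : K →+* K).toAddMonoidHom).ker)]
  congr 1
  ext y
  simp only [AddSubgroup.mem_inf]
  tauto

end Valued

end Literature.NumberTheory.Automorphic.UnitaryGroup
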